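import Summits.BirchSwinnertonDyer.BirchSwinnertonDyer.Theorems.SemiOrdinaryEisensteinDescentWildSigmaDivisibilityAtThreeMultiCarrierOfBeyondMaxOfManinGood
import Summits.BirchSwinnertonDyer.BirchSwinnertonDyer.Theorems.SchneiderFreeAdditiveX3PoitouTateUnramifiedOrthogonalAllLevels
import Literature.NumberTheory.GaloisCohomology.LocalInvariantMapConjCompatible
import HarnessLib

/-!
# Route `SemiOrdinaryEisensteinDescent` rev 18, research crux J‴ `WildSigmaDivisibilityAtThreeMultiCarrier` (stmt-BirchSwinnertonDyer-25898)
# and the banked Ko′ (24696): the Kolyvagin branch with its DUALITY input reduced to ONE printed statement — Milne *ADT* I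
# Thm. 4.10(b) `Ker γ¹ ⊆ Im β¹` for THE canonical local invariant maps (width seat `bsd-wall-soed-p2-w2` g6 = lead-of-record lineage
# on 25898; `--supports stmt-BirchSwinnertonDyer-25898`, helper)

WHY. Line `birth` of J‴ (`Cruxes/WildSigmaDivisibilityAtThreeMultiCarrier/Lines/birth.lean`, w2 g5) has three stubs: `stub_flatMultiCarrier`
(research: Büyükboduk 2009 §4.2 Q1 at the additive prime `3`), `stub_maninGood` (research: the `3`-part of Manin's conjecture at `27 ∣ N`)
and `stub_printConj := (∀ K, poitouTate_selmerStructure_duality_conj K) ∧ E0 ∧ 3.7 (2)` (print). The first conjunct of the print stub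
is the FIVE-conjunct Poitou–Tate fact for Selmer structures; of its five conjuncts FOUR are kernel theorems for THE canonical family
`LocalInvariants.canonical K n` — `canonical_isPerfect` (local Tate duality), `sumInvLocalizationEqZero_canonical_of_numberField`
(reciprocity), Milne I Thm. 2.6 (`PoitouTateReduction.unramifiedOrthogonal_of_isPerfect_allLevels`, cell bsd-schneider door-c4) and
`isConjCompatible_canonical` (bsd-jet) — and the fifth, Howard's `SelmerComplement`, follows at every level from Milne I Thm. 4.10(b)
`Ker γ¹ ⊆ Im β¹` for the canonical maps alone (`PoitouTateReduction.selmerComplement_canonical_of_middleExact_allLevels`, door-c6/c4).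
This file threads that reduction through the branch's normal forms (w3 g2 p609057, w2 g5 p606934):
* `wildSigmaDivisibilityAtThreeMultiCarrier_of_towerFree` — J′ (24702, aside) ⟹ J‴ BY NAME (the multi-carrier binder is dropped);
* `wildSigmaDivisibilityAtThreeMultiCarrier_of_flatBeyondMax_of_maninGood_of_middleExact` — **J‴ BY NAME ⟸ hE + E0 + 3.7 (2) + J⁗♭ + hGood**;
* `wildSigmaDivisibilityAtThreeMultiCarrier_of_lineStubs_of_middleExact` — **J‴ BY NAME ⟸ hE + E0 + 3.7 (2) + `stub_maninGood` +
  `stub_flatMultiCarrier`** (the line's composition with the PT conjunct of `stub_printConj` replaced by `hE`);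
* `wildKolyvaginUpperAtThreeTowerFree_of_flatBeyondMax_of_maninGood_of_middleExact` — **Ko′ BY NAME ⟸ CT + 3.7 (2) + E0 + hE + J⁗♭ + hGood**.
NET: the Kolyvagin column's displayed print is {CT (Ko′ only), E0, 3.7 (2), hE}; research = J⁗♭ (or `stub_flatMultiCarrier`) ⊕ Manin₃.
HONEST FRAMING: CONDITIONAL theorems; no definition, no named fact, no `sorry`; `hE` (class-formation half of Tate's theorem), E0, 3.7 (2),
CT are named print, undischarged; J⁗♭ / `stub_flatMultiCarrier` and Manin₃ are open research; J‴, Ko′, Manin's conjecture and BSD stay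
open — BSD is not proved by any of this.

References: [cite: MilneADT2006, Ch. I, Cor. 2.3, Thm. 2.6, Thm. 4.10(b)] [cite: Howard2004HeegnerKolyvagin, Thm. 2.1.11 (arXiv:1202.6340 p. 6)]
[cite: Neukirch2013, Ch. III §6] [cite: Jetchev2008, Thm. 1.4 and Conj. 1.3 (p. 812)] [cite: Buyukboduk2009TamagawaDefect, §4.2 Question 1]
[cite: McCallumLMS1991, §5 Cor. 5.6 (p. 310)] [cite: EdixhovenManin1991, §1].
-/

set_option autoImplicit false
set_option linter.dupNamespace false -- `Summit.BirchSwinnertonDyer.BirchSwinnertonDyer.…` is the tree's layout (D-0017)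

noncomputable section

open scoped Classical

namespace Summit.BirchSwinnertonDyer.BirchSwinnertonDyer.Theorems.WildSigmaDivisibilityAtThreeMultiCarrierOfMiddleExact

open WeierstrassCurve NumberField IsDedekindDomain Literature.NumberTheory.EllipticCurves
  Literature.NumberTheory.EllipticCurves.ModularForms
  Literature.NumberTheory.GaloisRepresentations Literature.NumberTheory.GaloisCohomology
  Summit.BirchSwinnertonDyer.Rank1Residual
  Summit.BirchSwinnertonDyer.Rank1Residual.Additive
  Summit.BirchSwinnertonDyer.Rank1Residual.X11b.Three
  Summit.BirchSwinnertonDyer.BirchSwinnertonDyer.Theses.SemiOrdinaryEisensteinDescent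
  Summit.BirchSwinnertonDyer.BirchSwinnertonDyer.Theorems.WildSigmaDivisibilityAtThreeMultiCarrierOfBeyondMaxOfManinGood
  Summit.BirchSwinnertonDyer.BirchSwinnertonDyer.Theorems.WildKolyvaginUpperAtThreeTowerFreeManinPrimitive
open Literature.NumberTheory.GaloisRepresentations.DiscreteGaloisModule (localTatePairingZMod unramifiedSubgroup)
open Literature.NumberTheory.EllipticCurves.GrossLMS1991 (prop37_2_frobeniusCongruence)
open Summit.BirchSwinnertonDyer.BirchSwinnertonDyer.Theorems.SchneiderFreeAdditiveX3.PoitouTateReduction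
  (unramifiedOrthogonal_of_isPerfect_allLevels selmerComplement_canonical_of_middleExact_allLevels)

/-! ## §0 The duality input: the five-conjunct fact from `hE` (private plumbing; public twin in `…JetchevMaxDivisibilityAtThreeModThreeOfMiddleExact`) -/

/-- The five-conjunct Poitou–Tate fact at every number field from Milne I Thm. 4.10(b) `Ker γ¹ ⊆ Im β¹` for THE canonical maps at every
`K`, `n` (the other four conjuncts are kernel theorems). [cite: MilneADT2006, Ch. I, Thm. 4.10(b)] [cite: Neukirch2013, Ch. III §6] -/
private theorem ptConj_of_hE
    (hE : ∀ (K : Type) [Field K] [NumberField K] (n : ℕ) [NeZero n],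
      ∀ ⦃M : Type⦄ [AddCommGroup M] [TopologicalSpace M] [DiscreteTopology M] [Finite M]
      (ρ : DiscreteGaloisModule K M), (∀ m : M, n • m = 0) →
      ∀ S : Finset (Place K), (∀ w : InfinitePlace K, (Sum.inl w : Place K) ∈ S) →
        (∀ v : HeightOneSpectrum (𝓞 K), (Sum.inr v : Place K) ∉ S →
          ((n : ℕ) : 𝓞 K) ∉ v.asIdeal ∧ GaloisRep.IsUnramifiedAt v ρ) →
        ∀ t : Π v : Place K, galoisCohomology (ρ.toLocal v) 1,
          (∀ y : galoisCohomology (ρ.tateDual n) 1,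
            (∀ v : HeightOneSpectrum (𝓞 K), (Sum.inr v : Place K) ∉ S →
              galoisCohomology.localization (ρ.tateDual n) (Sum.inr v) 1 y ∈
                unramifiedSubgroup (GaloisRep.toLocal v (ρ.tateDual n)) 1) →
            ∑ v ∈ S, localTatePairingZMod ρ n v (LocalInvariants.canonical K n v) (t v)
              (galoisCohomology.localization (ρ.tateDual n) v 1 y) = 0) →
          ∃ x : galoisCohomology ρ 1,
            (∀ v : HeightOneSpectrum (𝓞 K), (Sum.inr v : Place K) ∉ S →
              galoisCohomology.localization ρ (Sum.inr v) 1 x ∈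
                unramifiedSubgroup (GaloisRep.toLocal v ρ) 1) ∧
            ∀ v ∈ S, galoisCohomology.localization ρ v 1 x = t v) :
    ∀ (K : Type) [Field K] [NumberField K], poitouTate_selmerStructure_duality_conj K :=
  fun K _ _ ↦ poitouTate_selmerStructure_duality_conj_of_canonical_numberField K
    (fun n _ ↦ unramifiedOrthogonal_of_isPerfect_allLevels (LocalInvariants.canonical K n)
      LocalInvariants.canonical_isPerfect)
    (fun n _ ↦ selmerComplement_canonical_of_middleExact_allLevels n (hE K n))

/-! ## §1 J′ ⟹ J‴ by name -/

/-- **J′ `WildSigmaDivisibilityAtThreeTowerFree` (aside 24702: σ-divisibility on EVERY frame) implies J‴ `WildSigmaDivisibilityAtThreeMultiCarrier`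
(25898: the same on multi-carrier frames) BY NAME** — J‴ is J′ with one extra binder, which is discarded. [cite: Jetchev2008, Conj. 1.3 (p. 812)] -/
theorem wildSigmaDivisibilityAtThreeMultiCarrier_of_towerFree (hJ' : WildSigmaDivisibilityAtThreeTowerFree) :
    WildSigmaDivisibilityAtThreeMultiCarrier := by
  intro W _ _ N _ K _ _ Dt H ι P hO6 hsurj hr hN hK hHH hLd hP hnt hodd h3 _hmulti
  exact hJ' W N K Dt H ι P hO6 hsurj hr hN hK hHH hLd hP hnt hodd h3

/-! ## §2 J‴ BY NAME: normal form (depth residue J⁗♭ ⊕ hGood) and the line's stubs, duality input = `hE` -/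

/-- **Crux of record J‴ (25898) BY NAME ⟸ ONE printed duality statement `hE` (Milne I Thm. 4.10(b) `Ker γ¹ ⊆ Im β¹` for THE canonical maps,
every `K`, `n`) + E0 + 3.7 (2) + the depth residue J⁗♭ (`hFlatB`: `3^{s′} ∣ P(n)` for `max_q ord₃ c_q < s′ ≤ Σ_q ord₃ c_q` on data with `3 ∤ c`)
+ hGood («one `3`-good datum per curve of the cell»).** = w3 g2's normal form p609057 with `hPT` fed by §0. CONDITIONAL on the three named
print statements and the two research hypotheses; nothing asserted about any curve. [cite: MilneADT2006, Ch. I, Thm. 4.10(b)]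
[cite: Jetchev2008, Thm. 1.4 and Conj. 1.3 (p. 812)] [cite: Buyukboduk2009TamagawaDefect, §4.2 Question 1] [cite: EdixhovenManin1991, §1] -/
theorem wildSigmaDivisibilityAtThreeMultiCarrier_of_flatBeyondMax_of_maninGood_of_middleExact
    (hE : ∀ (K : Type) [Field K] [NumberField K] (n : ℕ) [NeZero n],
      ∀ ⦃M : Type⦄ [AddCommGroup M] [TopologicalSpace M] [DiscreteTopology M] [Finite M]
      (ρ : DiscreteGaloisModule K M), (∀ m : M, n • m = 0) →
      ∀ S : Finset (Place K), (∀ w : InfinitePlace K, (Sum.inl w : Place K) ∈ S) →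
        (∀ v : HeightOneSpectrum (𝓞 K), (Sum.inr v : Place K) ∉ S →
          ((n : ℕ) : 𝓞 K) ∉ v.asIdeal ∧ GaloisRep.IsUnramifiedAt v ρ) →
        ∀ t : Π v : Place K, galoisCohomology (ρ.toLocal v) 1,
          (∀ y : galoisCohomology (ρ.tateDual n) 1,
            (∀ v : HeightOneSpectrum (𝓞 K), (Sum.inr v : Place K) ∉ S →
              galoisCohomology.localization (ρ.tateDual n) (Sum.inr v) 1 y ∈
                unramifiedSubgroup (GaloisRep.toLocal v (ρ.tateDual n)) 1) →
            ∑ v ∈ S, localTatePairingZMod ρ n v (LocalInvariants.canonical K n v) (t v)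
              (galoisCohomology.localization (ρ.tateDual n) v 1 y) = 0) →
          ∃ x : galoisCohomology ρ 1,
            (∀ v : HeightOneSpectrum (𝓞 K), (Sum.inr v : Place K) ∉ S →
              galoisCohomology.localization ρ (Sum.inr v) 1 x ∈
                unramifiedSubgroup (GaloisRep.toLocal v ρ) 1) ∧
            ∀ v ∈ S, galoisCohomology.localization ρ v 1 x = t v)
    (hE0 : Gross1991_heegnerPoint_sub_ratTorsion_mem_E0) (h372 : prop37_2_frobeniusCongruence)
    (hFlatB : ∀ (W : WeierstrassCurve ℚ) [W.IsElliptic] [W.IsGloballyMinimal] (N : ℕ) [NeZero N] (K : Type)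
      [Field K] [NumberField K] (Dt : ModularParametrizationData W N)
      (H : HeegnerDatum N (NumberField.discr K)) (ι : K →+* ℂ) (P : (W.baseChange K).toAffine.Point),
      ClassO6 W 3 → W.HasSurjectiveModNGaloisRep 3 → W.analyticRank = 1 → W.conductorNorm ℤ = N →
      IsImaginaryQuadratic K → SatisfiesHeegnerHypothesis N K →
      (W.quadraticTwist (NumberField.discr K : ℚ)).entireLFunction 1 ≠ 0 →
      WeierstrassCurve.Affine.Point.map ι.toRatAlgHom P = heegnerPointComplex Dt H →
      ¬ IsOfFinAddOrder P → Odd (NumberField.discr K) → NumberField.discr K ≠ -3 →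
      ¬ (3 : ℤ) ∣ Dt.c →
      ∀ (s' : ℕ), (∀ (q : ℕ) [Fact q.Prime], q ∣ N →
        padicValNat 3 ((W.baseChange ℚ_[q]).localTamagawaNumber ℤ_[q]) < s') →
      s' ≤ padicValNat 3 W.tamagawaProduct + padicValNat 3 Dt.c.natAbs →
        ∀ (n : ℕ) (d : KolyvaginHeegnerData Dt H.β ι n), Squarefree n →
          (∀ ℓ ∈ n.primeFactors, Zhang2014.IsKolyvaginPrime N W K 3 ℓ ∧
            s' ≤ Zhang2014.kolyvaginIndex W 3 ℓ) → Koly.PDiv d 3 s')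
    (hGood : ∀ (W : WeierstrassCurve ℚ) [W.IsElliptic] [W.IsGloballyMinimal] (N : ℕ) [NeZero N],
      ClassO6 W 3 → W.HasSurjectiveModNGaloisRep 3 → W.analyticRank = 1 → W.conductorNorm ℤ = N →
      Nonempty (ModularParametrizationData W N) →
      ∃ Dt₀ : ModularParametrizationData W N, ¬ (3 : ℤ) ∣ Dt₀.c) :
    WildSigmaDivisibilityAtThreeMultiCarrier :=
  wildSigmaDivisibilityAtThreeMultiCarrier_of_flatBeyondMax_of_maninGood_of_threePrintFacts (ptConj_of_hE hE) hE0 h372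
    hFlatB hGood

/-- **Crux of record J‴ (25898) BY NAME from line `birth`'s two research stubs with the duality input = `hE`**: hypotheses `hE` (Milne I
Thm. 4.10(b) `Ker γ¹ ⊆ Im β¹` for THE canonical maps, every `K`, `n`), E0, 3.7 (2), `hPrim` (= `stub_maninGood` verbatim: the
`3`-primitive part of every datum's constant is admissible) and `hJmF` (= `stub_flatMultiCarrier` verbatim: J‴ on data with `3 ∤ c`,
i.e. ≥ 2 TAMAGAWA `3`-carriers). = the skeleton's composition `WildSigmaDivisibilityAtThreeMultiCarrier_of` (via w2 g5's p606934, which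
proves J′ on every frame) with the PT conjunct of `stub_printConj` replaced by `hE`; J′ ⟹ J‴ by §1. CONDITIONAL on all five displayed
hypotheses; nothing asserted. [cite: MilneADT2006, Ch. I, Thm. 4.10(b)] [cite: Jetchev2008, Rem. 1.2, Thm. 1.4 and Conj. 1.3 (p. 812)]
[cite: Buyukboduk2009TamagawaDefect, §4.2 Question 1] [cite: CesnaviciusNeururerSaha2023, Thm. 1.2] -/
theorem wildSigmaDivisibilityAtThreeMultiCarrier_of_lineStubs_of_middleExact
    (hE : ∀ (K : Type) [Field K] [NumberField K] (n : ℕ) [NeZero n],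
      ∀ ⦃M : Type⦄ [AddCommGroup M] [TopologicalSpace M] [DiscreteTopology M] [Finite M]
      (ρ : DiscreteGaloisModule K M), (∀ m : M, n • m = 0) →
      ∀ S : Finset (Place K), (∀ w : InfinitePlace K, (Sum.inl w : Place K) ∈ S) →
        (∀ v : HeightOneSpectrum (𝓞 K), (Sum.inr v : Place K) ∉ S →
          ((n : ℕ) : 𝓞 K) ∉ v.asIdeal ∧ GaloisRep.IsUnramifiedAt v ρ) →
        ∀ t : Π v : Place K, galoisCohomology (ρ.toLocal v) 1,
          (∀ y : galoisCohomology (ρ.tateDual n) 1,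
            (∀ v : HeightOneSpectrum (𝓞 K), (Sum.inr v : Place K) ∉ S →
              galoisCohomology.localization (ρ.tateDual n) (Sum.inr v) 1 y ∈
                unramifiedSubgroup (GaloisRep.toLocal v (ρ.tateDual n)) 1) →
            ∑ v ∈ S, localTatePairingZMod ρ n v (LocalInvariants.canonical K n v) (t v)
              (galoisCohomology.localization (ρ.tateDual n) v 1 y) = 0) →
          ∃ x : galoisCohomology ρ 1,
            (∀ v : HeightOneSpectrum (𝓞 K), (Sum.inr v : Place K) ∉ S →
              galoisCohomology.localization ρ (Sum.inr v) 1 x ∈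
                unramifiedSubgroup (GaloisRep.toLocal v ρ) 1) ∧
            ∀ v ∈ S, galoisCohomology.localization ρ v 1 x = t v)
    (hE0 : Gross1991_heegnerPoint_sub_ratTorsion_mem_E0) (h372 : prop37_2_frobeniusCongruence)
    (hPrim : ∀ (W : WeierstrassCurve ℚ) [W.IsElliptic] [W.IsGloballyMinimal] (N : ℕ) [NeZero N],
      ClassO6 W 3 → W.HasSurjectiveModNGaloisRep 3 → W.analyticRank = 1 → W.conductorNorm ℤ = N →
      ∀ (Dt : ModularParametrizationData W N), ∃ (c₁ k : ℤ), Dt.c = k * c₁ ∧ ¬ (3 : ℤ) ∣ c₁ ∧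
        ∀ z ∈ periodLattice Dt.f, (c₁ : ℂ) * z ∈ Dt.L.lattice)
    (hJmF : ∀ (W : WeierstrassCurve ℚ) [W.IsElliptic] [W.IsGloballyMinimal] (N : ℕ) [NeZero N] (K : Type)
      [Field K] [NumberField K] (Dt : ModularParametrizationData W N)
      (H : HeegnerDatum N (NumberField.discr K)) (ι : K →+* ℂ) (P : (W.baseChange K).toAffine.Point),
      ClassO6 W 3 → W.HasSurjectiveModNGaloisRep 3 → W.analyticRank = 1 → W.conductorNorm ℤ = N →
      IsImaginaryQuadratic K → SatisfiesHeegnerHypothesis N K →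
      (W.quadraticTwist (NumberField.discr K : ℚ)).entireLFunction 1 ≠ 0 →
      WeierstrassCurve.Affine.Point.map ι.toRatAlgHom P = heegnerPointComplex Dt H →
      ¬ IsOfFinAddOrder P → Odd (NumberField.discr K) → NumberField.discr K ≠ -3 →
      ¬ (3 : ℤ) ∣ Dt.c →
      (∀ (q : ℕ) [Fact q.Prime], q ∣ N →
        padicValNat 3 ((W.baseChange ℚ_[q]).localTamagawaNumber ℤ_[q]) <
          padicValNat 3 W.tamagawaProduct + padicValNat 3 Dt.c.natAbs) →
      ∀ (s' : ℕ), s' ≤ padicValNat 3 W.tamagawaProduct + padicValNat 3 Dt.c.natAbs →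
        ∀ (n : ℕ) (d : KolyvaginHeegnerData Dt H.β ι n), Squarefree n →
          (∀ ℓ ∈ n.primeFactors, Zhang2014.IsKolyvaginPrime N W K 3 ℓ ∧
            s' ≤ Zhang2014.kolyvaginIndex W 3 ℓ) → Koly.PDiv d 3 s') :
    WildSigmaDivisibilityAtThreeMultiCarrier :=
  wildSigmaDivisibilityAtThreeMultiCarrier_of_towerFree
    (wildSigmaDivisibilityAtThreeTowerFree_of_flatMultiCarrier_of_primitiveAdmissible_of_threePrintFacts
      (ptConj_of_hE hE) hE0 h372 hPrim hJmF)

/-! ## §3 Banked Ko′ BY NAME, duality input = `hE` -/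

/-- **Banked Ko′ `WildKolyvaginUpperAtThreeTowerFree` (stmt-24696) BY NAME ⟸ {CT, 3.7 (2), E0} + `hE` (Milne I Thm. 4.10(b) `Ker γ¹ ⊆ Im β¹`
for THE canonical maps, every `K`, `n`) + the depth residue J⁗♭ + hGood** — w3 g2's normal form p609057 with `hPT` fed by §0. CONDITIONAL
on all six displayed hypotheses; Ko′, J‴, Manin's conjecture and BSD stay open. [cite: McCallumLMS1991, §5 Cor. 5.6 (p. 310)]
[cite: MilneADT2006, Ch. I, Thm. 4.10(b)] [cite: Jetchev2008, Thm. 1.4 and Conj. 1.3 (p. 812)] [cite: Buyukboduk2009TamagawaDefect, §4.2 Question 1] -/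
theorem wildKolyvaginUpperAtThreeTowerFree_of_flatBeyondMax_of_maninGood_of_middleExact
    (hCT : ∀ (K : Type) [Field K] [NumberField K], casselsTate_levelInputs K)
    (h372 : prop37_2_frobeniusCongruence) (hE0 : Gross1991_heegnerPoint_sub_ratTorsion_mem_E0)
    (hE : ∀ (K : Type) [Field K] [NumberField K] (n : ℕ) [NeZero n],
      ∀ ⦃M : Type⦄ [AddCommGroup M] [TopologicalSpace M] [DiscreteTopology M] [Finite M]
      (ρ : DiscreteGaloisModule K M), (∀ m : M, n • m = 0) →
      ∀ S : Finset (Place K), (∀ w : InfinitePlace K, (Sum.inl w : Place K) ∈ S) →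
        (∀ v : HeightOneSpectrum (𝓞 K), (Sum.inr v : Place K) ∉ S →
          ((n : ℕ) : 𝓞 K) ∉ v.asIdeal ∧ GaloisRep.IsUnramifiedAt v ρ) →
        ∀ t : Π v : Place K, galoisCohomology (ρ.toLocal v) 1,
          (∀ y : galoisCohomology (ρ.tateDual n) 1,
            (∀ v : HeightOneSpectrum (𝓞 K), (Sum.inr v : Place K) ∉ S →
              galoisCohomology.localization (ρ.tateDual n) (Sum.inr v) 1 y ∈
                unramifiedSubgroup (GaloisRep.toLocal v (ρ.tateDual n)) 1) →
            ∑ v ∈ S, localTatePairingZMod ρ n v (LocalInvariants.canonical K n v) (t v)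
              (galoisCohomology.localization (ρ.tateDual n) v 1 y) = 0) →
          ∃ x : galoisCohomology ρ 1,
            (∀ v : HeightOneSpectrum (𝓞 K), (Sum.inr v : Place K) ∉ S →
              galoisCohomology.localization ρ (Sum.inr v) 1 x ∈
                unramifiedSubgroup (GaloisRep.toLocal v ρ) 1) ∧
            ∀ v ∈ S, galoisCohomology.localization ρ v 1 x = t v)
    (hFlatB : ∀ (W : WeierstrassCurve ℚ) [W.IsElliptic] [W.IsGloballyMinimal] (N : ℕ) [NeZero N] (K : Type)
      [Field K] [NumberField K] (Dt : ModularParametrizationData W N)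
      (H : HeegnerDatum N (NumberField.discr K)) (ι : K →+* ℂ) (P : (W.baseChange K).toAffine.Point),
      ClassO6 W 3 → W.HasSurjectiveModNGaloisRep 3 → W.analyticRank = 1 → W.conductorNorm ℤ = N →
      IsImaginaryQuadratic K → SatisfiesHeegnerHypothesis N K →
      (W.quadraticTwist (NumberField.discr K : ℚ)).entireLFunction 1 ≠ 0 →
      WeierstrassCurve.Affine.Point.map ι.toRatAlgHom P = heegnerPointComplex Dt H →
      ¬ IsOfFinAddOrder P → Odd (NumberField.discr K) → NumberField.discr K ≠ -3 →
      ¬ (3 : ℤ) ∣ Dt.c →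
      ∀ (s' : ℕ), (∀ (q : ℕ) [Fact q.Prime], q ∣ N →
        padicValNat 3 ((W.baseChange ℚ_[q]).localTamagawaNumber ℤ_[q]) < s') →
      s' ≤ padicValNat 3 W.tamagawaProduct + padicValNat 3 Dt.c.natAbs →
        ∀ (n : ℕ) (d : KolyvaginHeegnerData Dt H.β ι n), Squarefree n →
          (∀ ℓ ∈ n.primeFactors, Zhang2014.IsKolyvaginPrime N W K 3 ℓ ∧
            s' ≤ Zhang2014.kolyvaginIndex W 3 ℓ) → Koly.PDiv d 3 s')
    (hGood : ∀ (W : WeierstrassCurve ℚ) [W.IsElliptic] [W.IsGloballyMinimal] (N : ℕ) [NeZero N],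
      ClassO6 W 3 → W.HasSurjectiveModNGaloisRep 3 → W.analyticRank = 1 → W.conductorNorm ℤ = N →
      Nonempty (ModularParametrizationData W N) →
      ∃ Dt₀ : ModularParametrizationData W N, ¬ (3 : ℤ) ∣ Dt₀.c) :
    WildKolyvaginUpperAtThreeTowerFree :=
  wildKolyvaginUpperAtThreeTowerFree_of_flatBeyondMax_of_maninGood_of_fourPrimitives hCT h372 hE0 (ptConj_of_hE hE)
    hFlatB hGood

end Summit.BirchSwinnertonDyer.BirchSwinnertonDyer.Theorems.WildSigmaDivisibilityAtThreeMultiCarrierOfMiddleExact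

end
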